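import Literature.NumberTheory.EllipticCurves.ModularCurve
import Literature.NumberTheory.EllipticCurves.NewformPeterssonSize
import HarnessLib

/-!
# The Hoffstein–Lockhart lower bound for the Petersson norm of the newform of an elliptic curve
# — MERGED into `murty_petersson_newform_lower_bound`

This module used to vendor the named fact `HoffsteinLockhart1994_peterssonProduct_lower_bound`
(cite item `wi-08945`, support item `PeterssonLowerBound` of route `ABC/RibetTakahashiSplit`,
dropped from that route in its rev. 2): for every `ε > 0` a constant `c(ε) > 0` with
`c(ε) · N^{1-ε} ≤ Re (f, f)_{Γ₀(N)}` for the newform `f = D.f` of every modular parametrisation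
datum `D : ModularParametrizationData W N` of every elliptic curve `W/ℚ` at every level `N ≥ 1`,
`(f, f) = peterssonProduct (Gamma0 N) 2 f f` the tree's un-normalised Petersson norm.

That statement is the specialisation `f := D.f` (`D.isNewformOf : IsNewformOf W D.f`) of the named
fact `murty_petersson_newform_lower_bound` (`NewformPeterssonSize.lean`: the same inequality for
every `f ∈ S₂(Γ₀(N))` with `IsNewformOf W f`), i.e. the same theorem in print — M. R. Murty,
*Bounds for congruence primes* (1999), §2, proof of Thm. 1: "for any `ε > 0` and `N` greater than
some constant depending only on `ε`, we have the inequality `(1 − ε) log N < log (f, f) <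
(1 + ε) log N` […] By a result of Hoffstein and Lockhart [HL], we have `log (f, f) > (1 − ε) log N`"
— vendored twice. Review decision (D-0026/D-0027 review of the split/duplicate, 2026-08-15):
**merged**. The duplicate `def` is deleted (one corollary of its namespace is kept, re-fed; see
below); nothing is lost:

* the parametrisation-data form follows from `murty_petersson_newform_lower_bound` by the bridge
  `HoffsteinLockhart1994_peterssonProduct_lower_bound_of_murty` (`NewformPeterssonSizeProofs.lean`),
  restated below at this module's import level as `ModularParametrizationData.le_peterssonProduct_re_of_murty`
  for users of this module;
* its unconditional ranges `ε ≥ 1` (`HoffsteinLockhart1994_peterssonProduct_lower_bound_of_one_le`,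
  Pasten's trivial bound) and `ε > 1/2` (`HoffsteinLockhart1994_peterssonProduct_lower_bound_of_half_lt`,
  Iwaniec's elementary bound, `PeterssonNormLowerBoundSqrtProofs.lean`), the equivalence with the
  printed logarithmic form (`HoffsteinLockhart1994_peterssonProduct_lower_bound_iff_log`) and the
  reductions from the Rankin–Selberg residue / the naive symmetric-square value
  (`…_of_residue_lower_bound`, `…_of_symmSqLOne_lower_bound`) all remain, as theorems whose
  conclusion is the inequality spelled out;
* positivity `0 < Re (f, f)` is unconditional in the tree (`IsNewformOf.peterssonProduct_re_pos`,
  `peterssonProduct_self_pos_holds`); the old conditional corollary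
  `HoffsteinLockhart1994_peterssonProduct_lower_bound.peterssonProduct_re_pos` is kept under its
  name, now with hypothesis `murty_petersson_newform_lower_bound` (the other two corollaries,
  `….exists_const_le` and `….log_lower_bound`, are dropped: the former is the case `ε = 1` of the
  bridge below, the latter is `HoffsteinLockhart1994_peterssonProduct_lower_bound_iff_log`).

## Why the fact is not discharged here (size XL)

Given the tree, the residual content of `murty_petersson_newform_lower_bound` is exactly
Hoffstein–Lockhart's theorem `L(1, sym² f) ≫_ε N^{-ε}` for the newforms of elliptic curves over `ℚ`
(`murty_petersson_newform_lower_bound_iff_symmSqLOne_lower_bound`,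
`NewformPeterssonSizeSymmSquareConverseProofs.lean`). Its printed proof (J. Hoffstein, P. Lockhart,
Ann. of Math. 140 (1994), Thm. 0.1, with the appendix by Goldfeld–Hoffstein–Lieman; exposition:
D. Goldfeld, *Automorphic forms and L-functions for the group GL(n, ℝ)*, §8.6 Lemma 8.6.1,
§8.7 Thm. 8.7.6 and Cor. 8.7.7 with the Remark on congruence subgroups and holomorphic forms) runs
through the Gelbart–Jacquet lift of `f` to `GL(3)`, the symmetric-square `L`-function of that lift
(Bump–Ginzburg 1992), `GL(3) × GL(3)` Rankin–Selberg theory and the Siegel-zero lemma — a theory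
with no carrier in Mathlib or `Literature`. The elementary method of the tree reaches `N^{1/2-ε}`
only (Iwaniec, *Spectral methods*, Thm. 8.3 and p. 88).

## References

* [HoffsteinLockhart1994] J. Hoffstein, P. Lockhart, *Coefficients of Maass forms and the Siegel
  zero*, Ann. of Math. (2) 140 (1994), 161–181 (Appendix by D. Goldfeld, J. Hoffstein, D. Lieman,
  177–181). (Not held; acq-02177.)
* [Murty1999CongruencePrimes] M. R. Murty, *Bounds for congruence primes*, Proc. Sympos. Pure
  Math. 66.1 (1999), 177–192, §§1–2.
* [Watkins2004] M. Watkins, *Explicit lower bounds on the modular degree of an elliptic curve*,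
  arXiv:math/0408126, §1, Lemmas 3.1, 3.3, 3.4, §4 (explicit `L(Sym² f_E, 1) ≥ 0.033 / log N⁽²⁾`).
* [PastenShimura2024] H. Pasten, *Shimura curves and the abc conjecture*, J. Number Theory 254
  (2024), 214–335, §3.
* D. Goldfeld, *Automorphic forms and L-functions for the group GL(n, ℝ)*, Cambridge Studies in
  Advanced Mathematics 99 (2006), §§8.6–8.7 (read: PDF pp. 196–199).
-/

noncomputable section

open scoped MatrixGroups ModularForm

open CongruenceSubgroup

namespace Literature.NumberTheory.EllipticCurves.ModularForms

/-- **The parametrisation-data form of Murty's lower bound** (the statement formerly vendored here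
as the duplicate named fact `HoffsteinLockhart1994_peterssonProduct_lower_bound`): given
`murty_petersson_newform_lower_bound`, for every `ε > 0` there is `c > 0` with
`c · N^{1-ε} ≤ Re (f, f)` for the newform `f = D.f` of every modular parametrisation datum `D` of
every elliptic `W/ℚ` at every level `N ≥ 1` — apply the fact to `D.f`, `D.isNewformOf`. (The same
bridge, uncurried, is `HoffsteinLockhart1994_peterssonProduct_lower_bound_of_murty` in
`NewformPeterssonSizeProofs.lean`, which imports this module.)
[cite: Murty1999CongruencePrimes, §2 (proof of Thm. 1: "(1 − ε) log N < log (f, f) … by a result of Hoffstein and Lockhart")] -/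
theorem ModularParametrizationData.le_peterssonProduct_re_of_murty
    (h : murty_petersson_newform_lower_bound) {ε : ℝ} (hε : 0 < ε) :
    ∃ c : ℝ, 0 < c ∧ ∀ (N : ℕ) [NeZero N] (W : WeierstrassCurve ℚ) [W.IsElliptic]
      (D : ModularParametrizationData W N),
      c * (N : ℝ) ^ (1 - ε) ≤ (peterssonProduct (Gamma0 N) 2 D.f D.f).re := by
  obtain ⟨c, hc, hcN⟩ := h ε hε
  exact ⟨c, hc, fun N _ W _ D ↦ hcN N W D.f D.isNewformOf⟩

namespace HoffsteinLockhart1994_peterssonProduct_lower_bound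

variable {N : ℕ} [NeZero N] {W : WeierstrassCurve ℚ} [W.IsElliptic]

/-- Under Murty's lower bound the Petersson norm of the newform of a parametrisation datum has
positive real part (take `ε = 1`: `0 < c = c · N⁰ ≤ Re (f, f)`). This is the former corollary of
the merged duplicate fact, now fed by `murty_petersson_newform_lower_bound`; the name is kept for
stability. Unconditionally, positivity is `IsNewformOf.peterssonProduct_re_pos`
(`NewformPeterssonSizeProofs.lean`, Pasten's trivial bound) — prefer that. (Murty 1999, §2.)
[cite: Murty1999CongruencePrimes, §2 (proof of Thm. 1)] -/
theorem peterssonProduct_re_pos (h : murty_petersson_newform_lower_bound)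
    (D : ModularParametrizationData W N) : 0 < (peterssonProduct (Gamma0 N) 2 D.f D.f).re := by
  obtain ⟨c, hc, hcN⟩ := ModularParametrizationData.le_peterssonProduct_re_of_murty h one_pos
  have hN : (0 : ℝ) < N := by exact_mod_cast NeZero.pos N
  have hpos : 0 < c * (N : ℝ) ^ ((1 : ℝ) - 1) := mul_pos hc (Real.rpow_pos_of_pos hN _)
  exact hpos.trans_le (hcN N W D)

end HoffsteinLockhart1994_peterssonProduct_lower_bound

end Literature.NumberTheory.EllipticCurves.ModularForms

end
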